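import Mathlib
import HarnessLib
import Literature.Probability.LatticeModels.LatticeGreenFunction
import Literature.Probability.LatticeModels.TorusGreenHessianDecay
import Literature.MathematicalPhysics.QuantumFieldTheory.YangMillsOS

/-!
# Crux `FemtoCurvatureTwoPoint` (stmt-QuantumFields-9363, route `LangevinControlUV`), line
`generic-step-gamma-encoding`: stub `stub_greenHessianDecay`

K1b — the Hessian (mixed second differences) of the zero-mode-removed torus Green function on `(ℤ/L)⁴`
decays like `dist⁻⁴`, uniformly in `L`: `|∇ᵢ⁺∇ⱼ⁻ G̃_L(z)| · dist(0,z)⁴ ≤ C` for `z ≠ 0`.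

This is the tree theorem `Literature.Probability.LatticeModels.torusGreen_hessian_mul_dist_pow_four_le`
(`Literature/Probability/LatticeModels/TorusGreenHessianDecay.lean`), proved by the heat-kernel route
`SRWHeatKernelDifferences` → `TorusHeatKernel1D` → `TorusGreenHeatKernel` → `TorusGreenHessianDecay`:
`∇∇G̃_L = ∫₀^{L²} ∇∇[∏_μ q^L_s] ds + O(L⁻⁴)`, product heat kernel differences bounded by periodised
Gaussian-weighted bounds on `ℤ` (contour shift), `∫₀^∞ (s + M²)⁻³ ds = M⁻⁴/2`.
-/

noncomputable section

open scoped BigOperators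
open MeasureTheory Filter Topology
open Literature.MathematicalPhysics.QuantumFieldTheory Literature.Probability.LatticeModels

namespace Summit.QuantumFields.YangMills.Theorems.FemtoCurvatureTwoPoint

/-- **Stub `stub_greenHessianDecay`** of line `generic-step-gamma-encoding` (crux `FemtoCurvatureTwoPoint`, registered signature,
verbatim). -/
theorem stub_greenHessianDecay :
    ∃ C : ℝ, ∀ (L : ℕ) [NeZero L] (i j : Fin 4) (z : Fin 4 → ZMod L), z ≠ 0 →
      |Literature.Probability.LatticeModels.torusGreen (z + Pi.single i 1)
          - Literature.Probability.LatticeModels.torusGreen (z + Pi.single i 1 - Pi.single j 1)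
          - Literature.Probability.LatticeModels.torusGreen z
          + Literature.Probability.LatticeModels.torusGreen (z - Pi.single j 1)|
        * Real.sqrt (∑ k : Fin 4, (((z k).valMinAbs : ℤ) : ℝ) ^ 2) ^ 4 ≤ C :=
  Literature.Probability.LatticeModels.torusGreen_hessian_mul_dist_pow_four_le

end Summit.QuantumFields.YangMills.Theorems.FemtoCurvatureTwoPoint

end
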